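import Mathlib.Analysis.Calculus.LineDeriv.IntegrationByParts
import Mathlib.Analysis.Calculus.FDeriv.Symmetric
import Mathlib.Analysis.Calculus.ContDiff.Operations
import Mathlib.Analysis.SpecialFunctions.ExpDeriv
import Mathlib.MeasureTheory.Measure.Lebesgue.Complex
import HarnessLib

/-!
# Carleman's weighted `L²` estimate for the Cauchy–Riemann operator of a constant complex structure

Let `E` be a real normed space, `J : E →L[ℝ] E` with `J² = -1` (a constant complex structure) and
`g` a continuous symmetric bilinear form on `E` for which `J` is skew (`g (J a) b = - g a (J b)`)
and `g a a ≥ 0`. For `W : ℂ → E` of class `C²` with compact support and a `C²` weight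
`φ : ℂ → ℝ` we prove **Carleman's inequality**

  `τ ∫ (Δφ) e^{2τφ} g(W, W) ≤ ∫ e^{2τφ} g(∂ₓW + J ∂_yW, ∂ₓW + J ∂_yW)`     (all `τ : ℝ`)

(`carleman_dbar_estimate`; `∂ₓ = fderiv ℝ · z 1`, `∂_y = fderiv ℝ · z I`,
`Δφ = ∂ₓ∂ₓφ + ∂_y∂_yφ`). This is the `L²`-Carleman estimate behind the unique continuation of
solutions of `|∂ₓw + J ∂_y w| ≤ C |w|` (T. Carleman 1939, for first-order elliptic systems in two
variables; in the `e^{τφ}`-conjugation form of Hörmander). Proof: with `v = e^{τφ} W`,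
`e^{τφ}(∂ₓW + J∂_yW) = 𝒜v + 𝒮v`, `𝒜v = ∂ₓv - τ φ_y Jv` (`L²(g)`-antisymmetric),
`𝒮v = J∂_yv - τ φₓ v` (symmetric), and `2∫ g(𝒜v, 𝒮v) = τ ∫ Δφ g(v,v)` by three integrations by
parts (`integral_g_fderiv_J_fderiv_eq_zero`: `∫ g(∂ₓv, J∂_yv) = 0` by the symmetry of second
derivatives; `two_mul_integral_mul_g_fderiv`: `2∫ ψ g(∂ₑv, v) = -∫ (∂ₑψ) g(v,v)`), whence
`∫ g(𝒜v+𝒮v, 𝒜v+𝒮v) = ∫ g(𝒜v,𝒜v) + ∫ g(𝒮v,𝒮v) + τ∫Δφ g(v,v) ≥ τ ∫ Δφ g(v,v)`.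
Integration by parts is Mathlib's `integral_bilinear_hasLineDerivAt_right_eq_neg_left_of_integrable`
on `ℂ` with Lebesgue measure.

References: T. Carleman, *Sur un problème d'unicité pour les systèmes d'équations aux dérivées
partielles à deux variables indépendantes*, Ark. Mat. Astr. Fys. 26B (1939); L. Hörmander,
*The Analysis of Linear Partial Differential Operators* III, §17.2 (Carleman estimates with
weights `e^{τφ}`). Used in `Literature/Analysis/PDE/DbarWeakUniqueContinuation.lean` and for
McDuff's unique continuation lemma for `J`-holomorphic curves
(`Literature.Geometry.Symplectic.jHolomorphic_uniqueContinuation_const`).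
-/

noncomputable section

open MeasureTheory Complex Function

namespace Literature.Analysis.PDE.DbarCarleman

variable {E : Type*} [NormedAddCommGroup E] [NormedSpace ℝ E]

/-- A function vanishing wherever a compactly supported function's topological support ends has
compact support. [folklore] -/
theorem hasCompactSupport_of_notMem_tsupport {α β γ : Type*} [TopologicalSpace α] [Zero β]
    [Zero γ] {f : α → β} {f' : α → γ} (hf : HasCompactSupport f)
    (h : ∀ x, x ∉ tsupport f → f' x = 0) : HasCompactSupport f' :=
  HasCompactSupport.intro' hf (isClosed_tsupport f) h

/-- A continuous real function vanishing off the topological support of a compactly supported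
function is integrable (Lebesgue measure on `ℂ`). [folklore] -/
theorem integrable_of_continuous_of_tsupport {β : Type*} [Zero β] {W : ℂ → β}
    (hWc : HasCompactSupport W) {f : ℂ → ℝ} (hf : Continuous f)
    (h0 : ∀ z, z ∉ tsupport W → f z = 0) : Integrable f :=
  hf.integrable_of_hasCompactSupport (hasCompactSupport_of_notMem_tsupport hWc h0)

/-- A continuous bilinear pairing of a continuous function with a continuous compactly supported
function is integrable (Lebesgue measure on `ℂ`). [folklore] -/
theorem integrable_bilin_of_hasCompactSupport {F G : Type*} [NormedAddCommGroup F]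
    [NormedSpace ℝ F] [NormedAddCommGroup G] [NormedSpace ℝ G]
    (B : F →L[ℝ] G →L[ℝ] ℝ) {f : ℂ → F} {k : ℂ → G}
    (hf : Continuous f) (hk : Continuous k) (hkc : HasCompactSupport k) :
    Integrable (fun z => B (f z) (k z)) := by
  refine integrable_of_continuous_of_tsupport hkc ((B.continuous.comp hf).clm_apply hk) ?_
  intro z hz
  simp [image_eq_zero_of_notMem_tsupport hz]

/-- Outside the topological support of `f`, the Fréchet derivative of `f` vanishes. [folklore] -/
theorem fderiv_eq_zero_of_notMem_tsupport {F : Type*} [NormedAddCommGroup F] [NormedSpace ℝ F]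
    {f : ℂ → F} {z : ℂ} (hz : z ∉ tsupport f) : fderiv ℝ f z = 0 :=
  notMem_support.mp fun h => hz (support_fderiv_subset ℝ h)

/-- For a `C²` function `v`, the partial derivative `z ↦ ∂ₑ v (z) = fderiv ℝ v z e` has Fréchet
derivative `ζ ↦ (fderiv ℝ (fderiv ℝ v) z ζ) e`. [folklore] -/
theorem hasFDerivAt_fderiv_apply {F : Type*} [NormedAddCommGroup F] [NormedSpace ℝ F]
    {v : ℂ → F} (hv : ContDiff ℝ 2 v) (e z : ℂ) :
    HasFDerivAt (fun w => fderiv ℝ v w e) ((fderiv ℝ (fderiv ℝ v) z).flip e) z := by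
  have hDv1 : ContDiff ℝ 1 (fderiv ℝ v) := hv.fderiv_right (by norm_num)
  have h := ((hDv1.differentiable one_ne_zero z).hasFDerivAt).clm_apply (hasFDerivAt_const e z)
  simpa using h

section Bilinear

variable (J : E →L[ℝ] E) (g : E →L[ℝ] E →L[ℝ] ℝ)

/-- **First integration by parts.** For `v ∈ C²_c(ℂ; E)` and a symmetric continuous bilinear
form `g` for which `J` is skew, `∫ g(∂ₓ v, J ∂_y v) = 0`: integrating by parts once in `x` and
once in `y` expresses the integral as `∓ ∫ g(v, J ∂ₓ∂_y v)`, and the mixed partials agree.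
[folklore] -/
theorem integral_g_fderiv_J_fderiv_eq_zero (hsym : ∀ a b, g a b = g b a)
    (hskew : ∀ a b, g (J a) b = - g a (J b))
    {v : ℂ → E} (hv : ContDiff ℝ 2 v) (hvc : HasCompactSupport v) :
    ∫ z, g (fderiv ℝ v z 1) (J (fderiv ℝ v z I)) = 0 := by
  set Dv : ℂ → ℂ →L[ℝ] E := fderiv ℝ v with hDv_def
  set D2v : ℂ → ℂ →L[ℝ] ℂ →L[ℝ] E := fderiv ℝ Dv with hD2v_def
  have hDv1 : ContDiff ℝ 1 Dv := hv.fderiv_right (by norm_num)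
  have hvd : ∀ z, HasFDerivAt v (Dv z) z := fun z =>
    (hv.differentiable (by norm_num) z).hasFDerivAt
  have hcv : Continuous v := hv.continuous
  have hcDv : Continuous Dv := hDv1.continuous
  have hcD2v : Continuous D2v := hDv1.continuous_fderiv one_ne_zero
  have hde : ∀ (e z : ℂ), HasFDerivAt (fun w => Dv w e) ((D2v z).flip e) z :=
    fun e z => hasFDerivAt_fderiv_apply hv e z
  have hsymm : ∀ z, D2v z I 1 = D2v z 1 I := fun z =>
    (hv.contDiffAt.isSymmSndFDerivAt (by simp)) I 1
  have hDvc : HasCompactSupport Dv := hvc.fderiv ℝ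
  have hD2vc : HasCompactSupport D2v := hDvc.fderiv ℝ
  -- continuity of the players
  have hc1 : Continuous fun z => Dv z 1 := hcDv.clm_apply continuous_const
  have hcI : Continuous fun z => Dv z I := hcDv.clm_apply continuous_const
  have hcJI : Continuous fun z => J (Dv z I) := J.continuous.comp hcI
  have hc21I : Continuous fun z => D2v z 1 I :=
    (hcD2v.clm_apply continuous_const).clm_apply continuous_const
  have hc2I1 : Continuous fun z => D2v z I 1 :=
    (hcD2v.clm_apply continuous_const).clm_apply continuous_const
  -- compact supports of the players
  have hsJI : HasCompactSupport fun z => J (Dv z I) :=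
    hasCompactSupport_of_notMem_tsupport hDvc fun z hz => by
      simp [image_eq_zero_of_notMem_tsupport hz]
  have hsJ21I : HasCompactSupport fun z => J (D2v z 1 I) :=
    hasCompactSupport_of_notMem_tsupport hD2vc fun z hz => by
      simp [image_eq_zero_of_notMem_tsupport hz]
  -- (1) parts in the direction `1`:  ∫ g(v, J ∂ₓ∂_y v) = - ∫ g(∂ₓ v, J ∂_y v)
  have h1 : ∫ z, g (v z) (J (D2v z 1 I)) = - ∫ z, g (Dv z 1) (J (Dv z I)) := by
    refine integral_bilinear_hasLineDerivAt_right_eq_neg_left_of_integrable (μ := volume)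
      (f := v) (f' := fun z => Dv z 1) (g := fun z => J (Dv z I))
      (g' := fun z => J (D2v z 1 I)) (v := (1 : ℂ)) (B := g) ?_ ?_ ?_ ?_ ?_
    · exact integrable_bilin_of_hasCompactSupport g hc1 hcJI hsJI
    · exact integrable_bilin_of_hasCompactSupport g hcv (J.continuous.comp hc21I) hsJ21I
    · exact integrable_bilin_of_hasCompactSupport g hcv hcJI hsJI
    · intro z _
      exact (hvd z).hasLineDerivAt 1
    · intro z _
      have h := ((J.hasFDerivAt).comp z (hde I z)).hasLineDerivAt 1
      simpa [Function.comp_def] using h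
  -- (2) parts in the direction `I` with the form `(a, b) ↦ g a (J b)`:
  --     ∫ g(∂ₓ v, J ∂_y v) = - ∫ g(∂_y∂ₓ v, J v)
  have h2 : ∫ z, g (Dv z 1) (J (Dv z I)) = - ∫ z, g (D2v z I 1) (J (v z)) := by
    have h := integral_bilinear_hasLineDerivAt_right_eq_neg_left_of_integrable (μ := volume)
      (f := fun z => Dv z 1) (f' := fun z => D2v z I 1) (g := v)
      (g' := fun z => Dv z I) (v := I) (B := g.bilinearComp (ContinuousLinearMap.id ℝ E) J)
      ?_ ?_ ?_ ?_ ?_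
    · simpa [ContinuousLinearMap.bilinearComp_apply] using h
    · simpa [ContinuousLinearMap.bilinearComp_apply] using
        integrable_bilin_of_hasCompactSupport (g.bilinearComp (ContinuousLinearMap.id ℝ E) J)
          hc2I1 hcv hvc
    · simpa [ContinuousLinearMap.bilinearComp_apply] using
        integrable_bilin_of_hasCompactSupport (g.bilinearComp (ContinuousLinearMap.id ℝ E) J)
          hc1 hcI (hvc.fderiv_apply ℝ I)
    · simpa [ContinuousLinearMap.bilinearComp_apply] using
        integrable_bilin_of_hasCompactSupport (g.bilinearComp (ContinuousLinearMap.id ℝ E) J)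
          hc1 hcv hvc
    · intro z _
      have h := (hde 1 z).hasLineDerivAt I
      simpa using h
    · intro z _
      exact (hvd z).hasLineDerivAt I
  -- (3) combine: with symmetric mixed partials and skewness the two expressions are opposite
  have h3 : ∫ z, g (D2v z I 1) (J (v z)) = - ∫ z, g (v z) (J (D2v z 1 I)) := by
    rw [← integral_neg]
    refine integral_congr_ae (Filter.Eventually.of_forall fun z => ?_)
    simp only [hsymm z]
    rw [hsym, hskew]
  have h4 : ∫ z, g (Dv z 1) (J (Dv z I)) = - ∫ z, g (Dv z 1) (J (Dv z I)) := by
    calc ∫ z, g (Dv z 1) (J (Dv z I)) = ∫ z, g (v z) (J (D2v z 1 I)) := by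
          rw [h2, h3, neg_neg]
      _ = - ∫ z, g (Dv z 1) (J (Dv z I)) := h1
  linarith

/-- **Second integration by parts.** For `v ∈ C¹_c(ℂ; E)`, `ψ ∈ C¹(ℂ; ℝ)`, a direction `e` and a
symmetric continuous bilinear form `g`: `2 ∫ ψ g(∂ₑ v, v) = - ∫ (∂ₑ ψ) g(v, v)`
(`∂ₑ (ψ g(v,v)) = (∂ₑψ) g(v,v) + 2 ψ g(∂ₑ v, v)` integrates to zero). [folklore] -/
theorem two_mul_integral_mul_g_fderiv (hsym : ∀ a b, g a b = g b a)
    {v : ℂ → E} (hv : ContDiff ℝ 1 v) (hvc : HasCompactSupport v)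
    {ψ : ℂ → ℝ} (hψ : ContDiff ℝ 1 ψ) (e : ℂ) :
    2 * ∫ z, ψ z * g (fderiv ℝ v z e) (v z) = - ∫ z, fderiv ℝ ψ z e * g (v z) (v z) := by
  set Dv : ℂ → ℂ →L[ℝ] E := fderiv ℝ v with hDv_def
  have hvd : ∀ z, HasFDerivAt v (Dv z) z := fun z => (hv.differentiable one_ne_zero z).hasFDerivAt
  have hψd : ∀ z, HasFDerivAt ψ (fderiv ℝ ψ z) z := fun z =>
    (hψ.differentiable one_ne_zero z).hasFDerivAt
  have hcv : Continuous v := hv.continuous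
  have hcDv : Continuous Dv := hv.continuous_fderiv one_ne_zero
  have hcψ : Continuous ψ := hψ.continuous
  have hcDψ : Continuous (fderiv ℝ ψ) := hψ.continuous_fderiv one_ne_zero
  have hce : Continuous fun z => Dv z e := hcDv.clm_apply continuous_const
  have hcψe : Continuous fun z => fderiv ℝ ψ z e := hcDψ.clm_apply continuous_const
  -- the second factor `ψ • v` and its derivative in the direction `e`
  have hcG : Continuous fun z => ψ z • v z := hcψ.smul hcv
  have hcG' : Continuous fun z => ψ z • Dv z e + fderiv ℝ ψ z e • v z :=
    (hcψ.smul hce).add (hcψe.smul hcv)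
  have hsG : HasCompactSupport fun z => ψ z • v z :=
    hasCompactSupport_of_notMem_tsupport hvc fun z hz => by
      simp [image_eq_zero_of_notMem_tsupport hz]
  have hsG' : HasCompactSupport fun z => ψ z • Dv z e + fderiv ℝ ψ z e • v z :=
    hasCompactSupport_of_notMem_tsupport hvc fun z hz => by
      simp [image_eq_zero_of_notMem_tsupport hz, hDv_def, fderiv_eq_zero_of_notMem_tsupport hz]
  have h := integral_bilinear_hasLineDerivAt_right_eq_neg_left_of_integrable (μ := volume)
    (f := v) (f' := fun z => Dv z e) (g := fun z => ψ z • v z)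
    (g' := fun z => ψ z • Dv z e + fderiv ℝ ψ z e • v z) (v := e) (B := g) ?_ ?_ ?_ ?_ ?_
  · -- `h : ∫ g(v, ψ ∂ₑv + ∂ₑψ v) = - ∫ g(∂ₑ v, ψ v)`; split the left integral
    have hA : Integrable fun z => ψ z * g (Dv z e) (v z) := by
      have := integrable_bilin_of_hasCompactSupport g hce hcG hsG
      simpa [map_smul, smul_eq_mul] using this
    have hB : Integrable fun z => fderiv ℝ ψ z e * g (v z) (v z) := by
      have := integrable_bilin_of_hasCompactSupport g hcv (hcψe.smul hcv)
        (hasCompactSupport_of_notMem_tsupport hvc fun z hz => by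
          simp [image_eq_zero_of_notMem_tsupport hz])
      simpa [map_smul, smul_eq_mul] using this
    have hL : ∫ z, g (v z) (ψ z • Dv z e + fderiv ℝ ψ z e • v z)
        = (∫ z, ψ z * g (Dv z e) (v z)) + ∫ z, fderiv ℝ ψ z e * g (v z) (v z) := by
      rw [← integral_add hA hB]
      refine integral_congr_ae (Filter.Eventually.of_forall fun z => ?_)
      simp only [map_add, map_smul, smul_eq_mul]
      rw [hsym (v z) (Dv z e)]
    have hR : ∫ z, g (Dv z e) (ψ z • v z) = ∫ z, ψ z * g (Dv z e) (v z) := by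
      refine integral_congr_ae (Filter.Eventually.of_forall fun z => ?_)
      simp only [map_smul, smul_eq_mul]
    rw [hL, hR] at h
    linarith
  · have := integrable_bilin_of_hasCompactSupport g hce hcG hsG
    simpa using this
  · exact integrable_bilin_of_hasCompactSupport g hcv hcG' hsG'
  · exact integrable_bilin_of_hasCompactSupport g hcv hcG hsG
  · intro z _
    exact (hvd z).hasLineDerivAt e
  · intro z _
    have h := ((hψd z).smul (hvd z)).hasLineDerivAt e
    change HasLineDerivAt ℝ (ψ • v) _ z e
    simpa [add_comm] using h

/-- Pointwise polarisation for a symmetric bilinear form: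
`g(x+y, x+y) = g(x,x) + g(y,y) + 2 g(x,y)`. [folklore] -/
theorem g_add_self (hsym : ∀ a b, g a b = g b a) (x y : E) :
    g (x + y) (x + y) = g x x + g y y + 2 * g x y := by
  simp only [map_add, add_apply]
  rw [hsym y x]
  ring

/-- The cross term `g(𝒜, 𝒮)` of Carleman's decomposition, pointwise:
with `𝒜 = a - (τ φ_y) J u`, `𝒮 = J b - (τ φₓ) u` one has
`g(𝒜, 𝒮) = g(a, J b) - τ φₓ g(a, u) - τ φ_y g(b, u)` (using `g(Ju, Jb) = g(u, b)` and
`g(Ju, u) = 0`). [folklore] -/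
theorem g_cross_term (hJ : ∀ a, J (J a) = -a) (hsym : ∀ a b, g a b = g b a)
    (hskew : ∀ a b, g (J a) b = - g a (J b)) (a b u : E) (px py τ : ℝ) :
    g (a - (τ * py) • J u) (J b - (τ * px) • u)
      = g a (J b) - τ * px * g a u - τ * py * g b u := by
  have h1 : g (J u) (J b) = g b u := by
    rw [hskew, hJ, map_neg, neg_neg, hsym]
  have h2 : g (J u) u = 0 := by
    have h := hskew u u
    rw [hsym u (J u)] at h
    linarith
  simp only [map_sub, map_smul, sub_apply, smul_apply,
    smul_eq_mul, h1, h2]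
  ring

end Bilinear

/-- **Carleman's weighted `L²` estimate for `∂ₓ + J ∂_y`** (Carleman 1939; Hörmander's
`e^{τφ}`-conjugation form). Let `J : E →L[ℝ] E` with `J² = -1`, `g` a continuous symmetric
bilinear form with `g(Ja, b) = -g(a, Jb)` and `g(a, a) ≥ 0`, `W ∈ C²_c(ℂ; E)`, `φ ∈ C²(ℂ; ℝ)`
and `τ ∈ ℝ`. Then
`τ ∫ (∂ₓ∂ₓφ + ∂_y∂_yφ) e^{2τφ} g(W, W) ≤ ∫ e^{2τφ} g(∂ₓW + J∂_yW, ∂ₓW + J∂_yW)`.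
[folklore] -/
theorem carleman_dbar_estimate (J : E →L[ℝ] E) (g : E →L[ℝ] E →L[ℝ] ℝ)
    (hJ : ∀ a, J (J a) = -a) (hsym : ∀ a b, g a b = g b a)
    (hskew : ∀ a b, g (J a) b = - g a (J b)) (hpos : ∀ a, 0 ≤ g a a)
    {W : ℂ → E} (hW : ContDiff ℝ 2 W) (hWc : HasCompactSupport W)
    {φ : ℂ → ℝ} (hφ : ContDiff ℝ 2 φ) (τ : ℝ) :
    τ * ∫ z, (fderiv ℝ (fun w => fderiv ℝ φ w 1) z 1 + fderiv ℝ (fun w => fderiv ℝ φ w I) z I)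
        * (Real.exp (2 * τ * φ z) * g (W z) (W z))
      ≤ ∫ z, Real.exp (2 * τ * φ z) *
          g (fderiv ℝ W z 1 + J (fderiv ℝ W z I)) (fderiv ℝ W z 1 + J (fderiv ℝ W z I)) := by
  -- players attached to `φ`
  set φ' : ℂ → ℂ →L[ℝ] ℝ := fderiv ℝ φ with hφ'_def
  have hφ'1 : ContDiff ℝ 1 φ' := hφ.fderiv_right (by norm_num)
  have hφd : ∀ z, HasFDerivAt φ (φ' z) z := fun z =>
    (hφ.differentiable (by norm_num) z).hasFDerivAt
  have hψx : ContDiff ℝ 1 fun w => φ' w 1 := hφ'1.clm_apply contDiff_const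
  have hψy : ContDiff ℝ 1 fun w => φ' w I := hφ'1.clm_apply contDiff_const
  -- players attached to `W`
  set DW : ℂ → ℂ →L[ℝ] E := fderiv ℝ W with hDW_def
  have hWd : ∀ z, HasFDerivAt W (DW z) z := fun z =>
    (hW.differentiable (by norm_num) z).hasFDerivAt
  have hcW : Continuous W := hW.continuous
  have hcDW : Continuous DW := hW.continuous_fderiv (by norm_num)
  -- the conjugated function `v = e^{τφ} W`
  set ex : ℂ → ℝ := fun z => Real.exp (τ * φ z) with hex_def
  set v : ℂ → E := fun z => ex z • W z with hv_def
  have hexC : ContDiff ℝ 2 ex := Real.contDiff_exp.comp (contDiff_const.mul hφ)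
  have hv : ContDiff ℝ 2 v := hexC.smul hW
  have hvc : HasCompactSupport v := hWc.smul_left
  have hexd : ∀ z, HasFDerivAt ex (Real.exp (τ * φ z) • (τ • φ' z)) z := by
    intro z
    have h := (Real.hasDerivAt_exp (τ * φ z)).comp_hasFDerivAt z ((hφd z).const_mul τ)
    exact h
  have hvd : ∀ z, HasFDerivAt v
      (ex z • DW z + (Real.exp (τ * φ z) • (τ • φ' z)).smulRight (W z)) z :=
    fun z => (hexd z).smul (hWd z)
  have hDv : ∀ z e, fderiv ℝ v z e = ex z • DW z e + (ex z * (τ * φ' z e)) • W z := by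
    intro z e
    rw [(hvd z).fderiv]
    simp [hex_def, smul_smul, mul_assoc]
  -- the three integral identities for `v`
  have i1 := integral_g_fderiv_J_fderiv_eq_zero J g hsym hskew hv hvc
  have i2x := two_mul_integral_mul_g_fderiv g hsym (hv.of_le (by norm_num)) hvc hψx 1
  have i2y := two_mul_integral_mul_g_fderiv g hsym (hv.of_le (by norm_num)) hvc hψy I
  -- pointwise: `𝒜 + 𝒮 = e^{τφ} (∂ₓ W + J ∂_y W)` and the expansion of `g(𝒜+𝒮, 𝒜+𝒮)`
  have hsum : ∀ z, (fderiv ℝ v z 1 - (τ * φ' z I) • J (v z)) + (J (fderiv ℝ v z I) - (τ * φ' z 1) • v z)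
      = ex z • (DW z 1 + J (DW z I)) := by
    intro z
    rw [hDv z 1, hDv z I]
    simp only [hv_def, map_add, map_smul, smul_add]
    module
  have hexp2 : ∀ z, ex z * ex z = Real.exp (2 * τ * φ z) := by
    intro z
    rw [hex_def, ← Real.exp_add]
    ring_nf
  have hgvv : ∀ z, g (v z) (v z) = Real.exp (2 * τ * φ z) * g (W z) (W z) := by
    intro z
    simp only [hv_def, map_smul, smul_apply, smul_eq_mul]
    rw [← mul_assoc, hexp2 z]
  have hpt : ∀ z, 2 * (g (fderiv ℝ v z 1) (J (fderiv ℝ v z I))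
        - τ * φ' z 1 * g (fderiv ℝ v z 1) (v z) - τ * φ' z I * g (fderiv ℝ v z I) (v z))
      ≤ Real.exp (2 * τ * φ z) *
          g (DW z 1 + J (DW z I)) (DW z 1 + J (DW z I)) := by
    intro z
    have hx := g_add_self g hsym (fderiv ℝ v z 1 - (τ * φ' z I) • J (v z))
      (J (fderiv ℝ v z I) - (τ * φ' z 1) • v z)
    rw [hsum z, g_cross_term J g hJ hsym hskew] at hx
    simp only [map_smul, smul_apply, smul_eq_mul] at hx
    rw [← mul_assoc, hexp2 z] at hx
    nlinarith [hpos (fderiv ℝ v z 1 - (τ * φ' z I) • J (v z)),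
      hpos (J (fderiv ℝ v z I) - (τ * φ' z 1) • v z)]
  -- integrability of everything in sight (continuous, supported in `tsupport v` or `tsupport W`)
  have hcv : Continuous v := hv.continuous
  have hcDvf : Continuous (fderiv ℝ v) := hv.continuous_fderiv (by norm_num)
  have hcφ' : Continuous φ' := hφ'1.continuous
  have hv0 : ∀ z, z ∉ tsupport v → v z = 0 := fun z hz => image_eq_zero_of_notMem_tsupport hz
  have hDv0 : ∀ z, z ∉ tsupport v → fderiv ℝ v z = 0 := fun z hz =>
    fderiv_eq_zero_of_notMem_tsupport hz
  have hI1 : Integrable fun z => g (fderiv ℝ v z 1) (J (fderiv ℝ v z I)) :=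
    integrable_of_continuous_of_tsupport hvc (by fun_prop) fun z hz => by simp [hDv0 z hz]
  have hI2 : Integrable fun z => τ * φ' z 1 * g (fderiv ℝ v z 1) (v z) :=
    integrable_of_continuous_of_tsupport hvc (by fun_prop) fun z hz => by simp [hv0 z hz]
  have hI3 : Integrable fun z => τ * φ' z I * g (fderiv ℝ v z I) (v z) :=
    integrable_of_continuous_of_tsupport hvc (by fun_prop) fun z hz => by simp [hv0 z hz]
  have hcψx' : Continuous fun z => fderiv ℝ (fun w => φ' w 1) z 1 :=
    (hψx.continuous_fderiv one_ne_zero).clm_apply continuous_const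
  have hcψy' : Continuous fun z => fderiv ℝ (fun w => φ' w I) z I :=
    (hψy.continuous_fderiv one_ne_zero).clm_apply continuous_const
  have hI4 : Integrable fun z => fderiv ℝ (fun w => φ' w 1) z 1 * g (v z) (v z) :=
    integrable_of_continuous_of_tsupport hvc (hcψx'.mul (by fun_prop)) fun z hz => by
      simp [hv0 z hz]
  have hI5 : Integrable fun z => fderiv ℝ (fun w => φ' w I) z I * g (v z) (v z) :=
    integrable_of_continuous_of_tsupport hvc (hcψy'.mul (by fun_prop)) fun z hz => by
      simp [hv0 z hz]
  have hW0 : ∀ z, z ∉ tsupport W → W z = 0 := fun z hz => image_eq_zero_of_notMem_tsupport hz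
  have hDW0 : ∀ z, z ∉ tsupport W → DW z = 0 := fun z hz =>
    fderiv_eq_zero_of_notMem_tsupport hz
  have hI6 : Integrable fun z => Real.exp (2 * τ * φ z) *
      g (DW z 1 + J (DW z I)) (DW z 1 + J (DW z I)) :=
    integrable_of_continuous_of_tsupport hWc
      ((Real.continuous_exp.comp (continuous_const.mul hφ.continuous)).mul (by fun_prop))
      fun z hz => by simp [hDW0 z hz]
  -- integrate the pointwise inequality
  have hmono : ∫ z, 2 * (g (fderiv ℝ v z 1) (J (fderiv ℝ v z I))
        - τ * φ' z 1 * g (fderiv ℝ v z 1) (v z) - τ * φ' z I * g (fderiv ℝ v z I) (v z))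
      ≤ ∫ z, Real.exp (2 * τ * φ z) * g (DW z 1 + J (DW z I)) (DW z 1 + J (DW z I)) :=
    integral_mono (((hI1.sub hI2).sub hI3).const_mul 2) hI6 hpt
  have hleft : ∫ z, 2 * (g (fderiv ℝ v z 1) (J (fderiv ℝ v z I))
        - τ * φ' z 1 * g (fderiv ℝ v z 1) (v z) - τ * φ' z I * g (fderiv ℝ v z I) (v z))
      = τ * ∫ z, (fderiv ℝ (fun w => φ' w 1) z 1 + fderiv ℝ (fun w => φ' w I) z I)
          * (Real.exp (2 * τ * φ z) * g (W z) (W z)) := by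
    have hI12 : Integrable fun z => g (fderiv ℝ v z 1) (J (fderiv ℝ v z I))
        - τ * φ' z 1 * g (fderiv ℝ v z 1) (v z) := hI1.sub hI2
    rw [integral_const_mul, integral_sub hI12 hI3, integral_sub hI1 hI2, i1]
    have ex2 : ∫ z, τ * φ' z 1 * g (fderiv ℝ v z 1) (v z)
        = τ * ∫ z, φ' z 1 * g (fderiv ℝ v z 1) (v z) := by
      rw [← integral_const_mul]
      refine integral_congr_ae (Filter.Eventually.of_forall fun z => ?_)
      simp only [mul_assoc]
    have ey2 : ∫ z, τ * φ' z I * g (fderiv ℝ v z I) (v z)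
        = τ * ∫ z, φ' z I * g (fderiv ℝ v z I) (v z) := by
      rw [← integral_const_mul]
      refine integral_congr_ae (Filter.Eventually.of_forall fun z => ?_)
      simp only [mul_assoc]
    have esum : ∫ z, (fderiv ℝ (fun w => φ' w 1) z 1 + fderiv ℝ (fun w => φ' w I) z I)
          * (Real.exp (2 * τ * φ z) * g (W z) (W z))
        = (∫ z, fderiv ℝ (fun w => φ' w 1) z 1 * g (v z) (v z))
          + ∫ z, fderiv ℝ (fun w => φ' w I) z I * g (v z) (v z) := by
      rw [← integral_add hI4 hI5]
      refine integral_congr_ae (Filter.Eventually.of_forall fun z => ?_)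
      simp only [hgvv z]
      ring
    rw [ex2, ey2, esum]
    have hx2 : τ * ∫ z, φ' z 1 * g (fderiv ℝ v z 1) (v z)
        = - (τ / 2) * ∫ z, fderiv ℝ (fun w => φ' w 1) z 1 * g (v z) (v z) := by
      have := i2x
      linear_combination (τ / 2) * i2x
    have hy2 : τ * ∫ z, φ' z I * g (fderiv ℝ v z I) (v z)
        = - (τ / 2) * ∫ z, fderiv ℝ (fun w => φ' w I) z I * g (v z) (v z) := by
      linear_combination (τ / 2) * i2y
    rw [hx2, hy2]
    ring
  rw [hleft] at hmono
  exact hmono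

end Literature.Analysis.PDE.DbarCarleman
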